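import Literature.AlgebraicGeometry.HodgeTheory.AlgebraicityLocusIUnionClosedProofs
import Literature.AlgebraicGeometry.Motives.VeryGeneralComplexPoint
import Literature.AlgebraicGeometry.HodgeTheory.RelativeHyperplaneClassHodgeRiemann
import HarnessLib

/-!
# Algebraicity spreads from a non-empty Zariski-open set of fibres to all fibres (stub `stub_spread` of crux `HyperbolicEightfoldsSqrtMinus7`)

Route `HeckePrymWeil` (sub-problem `HodgeConjecture`), crux `HeckePrymWeil.HyperbolicEightfoldsSqrtMinus7`
(stmt-HodgeConjecture-14642), line `euler-squeeze-rank-two-secant-bundle`, skeleton v4, registered stub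
`stub_spread` (K), proved verbatim.

For a smooth projective family `f : 𝒳 → S` embedded in `ℙᴹ × S` over a smooth irreducible
quasi-projective base and a global class `A ∈ H²ᵖ(𝒳(ℂ); ℂ)`: if the fibre restriction `A|_{𝒳_t}`
is an algebraic class for every complex point `t` of a non-empty Zariski-open `V ⊆ S`, then it is
algebraic on EVERY fibre. Proof, entirely from theorems of the tree: the algebraicity locus
`{t ∈ S(ℂ) | A|_{𝒳_t} algebraic}` equals `⋃ⱼ Wⱼ(ℂ)` for countably many Zariski-closed `Wⱼ ⊆ S`
(`charlesSchnell_algebraicityLocus_iUnion_closed_holds`, the discharged Charles–Schnell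
Prop. 11.3.11; the total space is quasi-projective by
`IsQuasiProjectiveOver.of_isClosedImmersion_projectiveSpace_tensor`). If every `Wⱼ` were a proper
subset, the very general point device (`ComplexPoints.exists_mem_forall_pt_not_mem`: `S(ℂ)` is
Baire, `(S ∖ Wⱼ)(ℂ)` dense open for `S` irreducible) would give a complex point of the non-empty
analytic open `V(ℂ)` (non-empty by `ComplexPoints.dense_setOf_pt_not_mem`, since a complex point
of `S` is given) outside all `Wⱼ`, contradicting the hypothesis on `V`. Hence some `Wⱼ = S` and
the locus is all of `S(ℂ)`. No `sorry`, no new definition, no named fact.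
-/

noncomputable section

-- single-problem summit (Problem = Summit): the mandated namespace repeats `HodgeConjecture`.
set_option linter.dupNamespace false

open CategoryTheory AlgebraicGeometry Limits MonoidalCategory CartesianMonoidalCategory
open Literature.AlgebraicGeometry Literature.AlgebraicGeometry.Motives Literature.AlgebraicGeometry.HodgeTheory
open Literature.AlgebraicTopology.SingularHomology

namespace Summit.HodgeConjecture.HodgeConjecture.Theorems.HyperbolicEightfoldsSqrtMinus7.AnchorObjectBS

/-- **K — algebraicity SPREADS from a non-empty Zariski-open set of fibres to all fibres** (the
registered statement of `stub_spread`, verbatim). For a smooth projective family `f : 𝒳 → S`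
embedded in `ℙᴹ × S` over a smooth irreducible quasi-projective base and a global class
`A ∈ H²ᵖ(𝒳(ℂ); ℂ)`: if `A|_{𝒳_t}` is algebraic for every complex point `t` of a non-empty
Zariski-open `V ⊆ S`, then it is algebraic on every fibre. The algebraicity locus is `⋃ⱼ Wⱼ(ℂ)`
for countably many Zariski-closed `Wⱼ` (`charlesSchnell_algebraicityLocus_iUnion_closed_holds`);
if all `Wⱼ` were proper, a very general complex point of `V(ℂ)` (Baire on `S(ℂ)`, `S`
irreducible: `ComplexPoints.exists_mem_forall_pt_not_mem`) would lie outside the locus; so some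
`Wⱼ = S`. [cite: CharlesSchnell2014Notes, Prop. 11.3.11 (proof)]
[cite: VoisinHodgeII2003, §3.3.1 and §7.3.2 (proof of Thm. 7.19)]
[cite: Arapura2022, proof of Cor. 1.5] -/
theorem stub_spread :
    ∀ ⦃𝒳 S : SchemeOver ℂ⦄ (f : 𝒳 ⟶ S) (N p : ℕ), IsSmoothProjectiveFamily f N →
      (∃ (M : ℕ) (ι : 𝒳 ⟶ MonoidalCategoryStruct.tensorObj (projectiveSpace M ℂ) S),
        IsClosedImmersion ι.left ∧ ι ≫ CartesianMonoidalCategory.snd (projectiveSpace M ℂ) S = f) →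
      IrreducibleSpace S.left → AlgebraicGeometry.Smooth S.hom → IsQuasiProjectiveOver S →
      ∀ (A : complexBetti 𝒳 (2 * p)) (V : Set S.left), IsOpen V → V.Nonempty →
        (∀ t : ComplexPoints S, t.pt ∈ V →
          complexBetti.map (fiberι f t) (2 * p) A ∈ algebraicClasses (fiberOver f t) p) →
        ∀ t : ComplexPoints S, complexBetti.map (fiberι f t) (2 * p) A ∈ algebraicClasses (fiberOver f t) p := by
  intro 𝒳 S f N p hf hι hirr hSm hS A V hV hVne hAV t
  obtain ⟨M, ι, hιc, -⟩ := hι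
  haveI := hιc
  have h𝒳 : IsQuasiProjectiveOver 𝒳 :=
    IsQuasiProjectiveOver.of_isClosedImmersion_projectiveSpace_tensor ι hS
  -- the algebraicity locus is a countable union of complex points of Zariski-closed subsets
  obtain ⟨W, hWc, hW⟩ := charlesSchnell_algebraicityLocus_iUnion_closed_holds f N p h𝒳 hS hSm hf A
  haveI : IsSeparated S.hom := hS.isSeparated
  haveI : LocallyOfFiniteType S.hom := hS.locallyOfFiniteType
  -- it suffices that one of the closed sets is everything
  suffices h : ∃ j, W j = Set.univ by
    obtain ⟨j, hj⟩ := h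
    have ht : t ∈ ⋃ j, {t : ComplexPoints S | t.pt ∈ W j} :=
      Set.mem_iUnion.2 ⟨j, by rw [Set.mem_setOf_eq, hj]; exact Set.mem_univ _⟩
    exact (Set.ext_iff.1 hW t).2 ht
  by_contra hex
  have hne : ∀ j, W j ≠ Set.univ := fun j hj => hex ⟨j, hj⟩
  -- `V(ℂ)` is a non-empty analytic open subset of `S(ℂ)`
  have hopen : IsOpen {P : ComplexPoints S | P.pt ∈ V} :=
    AlgPoints.isOpen_setOf_pt_mem (X := S) (L := ℂ) ⟨V, hV⟩
  have hne' : {P : ComplexPoints S | P.pt ∈ V}.Nonempty := by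
    haveI : Nonempty (ComplexPoints S) := ⟨t⟩
    have hd := ComplexPoints.dense_setOf_pt_not_mem (X := S) (C := Vᶜ) hV.isClosed_compl
      (Set.compl_ne_univ.2 hVne)
    obtain ⟨P, hP⟩ := hd.nonempty
    exact ⟨P, by simpa using hP⟩
  -- a very general complex point of `V(ℂ)` lies outside every `W j`: contradiction
  obtain ⟨P, hPV, hP⟩ := ComplexPoints.exists_mem_forall_pt_not_mem hWc hne hopen hne'
  have hPmem := (Set.ext_iff.1 hW P).1 (hAV P hPV)
  obtain ⟨j, hj⟩ := Set.mem_iUnion.1 hPmem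
  exact hP j hj

end Summit.HodgeConjecture.HodgeConjecture.Theorems.HyperbolicEightfoldsSqrtMinus7.AnchorObjectBS

end
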